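import Literature.Topology.FourManifolds.TautFoliationsTameFunctions
import HarnessLib

/-!
# Monotone, constant and injective continuous functions are tame

Sibling of `TautFoliationsTameFunctions.lean`: the elementary sources of tame functions used
for the heights of a fence read on the edges of a grid (constant along the closed horizontals,
continuous and injective — hence strictly monotone — along the verticals).

* `isTameOn_of_strictMonoOn`, `isTameOn_of_strictAntiOn`, `isTameOn_of_forall_eq`,
  `isTameOn_of_injOn` (**proved**).

All statements are [folklore].
-/

noncomputable section

open Set Function

namespace Literature.Topology.FourManifolds

namespace TameFunction

variable {f : ℝ → ℝ} {a b : ℝ}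

/-- A continuous strictly increasing function is tame. [folklore] -/
theorem isTameOn_of_strictMonoOn (hc : ContinuousOn f (Icc a b)) (hm : StrictMonoOn f (Icc a b)) : IsTameOn f a b := by
  refine ⟨hc, fun x hx ↦ ⟨b - x, by linarith [hx.2], Or.inl (hm.mono ?_)⟩, fun x hx ↦ ⟨x - a, by linarith [hx.1], Or.inl (hm.mono ?_)⟩⟩
  · rw [add_sub_cancel]; exact Icc_subset_Icc_left hx.1
  · rw [sub_sub_cancel]; exact Icc_subset_Icc_right hx.2

/-- A continuous strictly decreasing function is tame. [folklore] -/
theorem isTameOn_of_strictAntiOn (hc : ContinuousOn f (Icc a b)) (hm : StrictAntiOn f (Icc a b)) : IsTameOn f a b := by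
  refine ⟨hc, fun x hx ↦ ⟨b - x, by linarith [hx.2], Or.inr (Or.inl (hm.mono ?_))⟩,
    fun x hx ↦ ⟨x - a, by linarith [hx.1], Or.inr (Or.inl (hm.mono ?_))⟩⟩
  · rw [add_sub_cancel]; exact Icc_subset_Icc_left hx.1
  · rw [sub_sub_cancel]; exact Icc_subset_Icc_right hx.2

/-- A function constant on `[a, b]` is tame. [folklore] -/
theorem isTameOn_of_forall_eq {c : ℝ} (hf : ∀ x ∈ Icc a b, f x = c) : IsTameOn f a b := by
  have hc : ContinuousOn f (Icc a b) := continuousOn_const.congr hf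
  refine ⟨hc, fun x hx ↦ ⟨b - x, by linarith [hx.2], Or.inr (Or.inr fun y hy ↦ ?_)⟩,
    fun x hx ↦ ⟨x - a, by linarith [hx.1], Or.inr (Or.inr fun y hy ↦ ?_)⟩⟩
  · rw [add_sub_cancel] at hy
    rw [hf y ⟨hx.1.trans hy.1, hy.2⟩, hf x ⟨hx.1, hx.2.le⟩]
  · rw [sub_sub_cancel] at hy
    rw [hf y ⟨hy.1, hy.2.trans hx.2⟩, hf x ⟨hx.1.le, hx.2⟩]

/-- **A continuous injective function on `[a, b]` is tame** (it is strictly monotone).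
[folklore] -/
theorem isTameOn_of_injOn (hab : a ≤ b) (hc : ContinuousOn f (Icc a b)) (hi : InjOn f (Icc a b)) : IsTameOn f a b := by
  rcases hc.strictMonoOn_of_injOn_Icc' hab hi with h | h
  · exact isTameOn_of_strictMonoOn hc h
  · exact isTameOn_of_strictAntiOn hc h

end TameFunction

end Literature.Topology.FourManifolds
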